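import Literature.MathematicalPhysics.KineticTheory.HardSphereBBGKYLiouvilleFlow
import Literature.MathematicalPhysics.KineticTheory.HardSphereEuler

/-!
# First lemma of line `FirstLemma` (idea `kifer-compactification`) — crux stmt-AtomisticToContinuum-14135
`AntiMazurCoboundaries.CorrectorPressureDecay`

Registered stub `stub_almostStationaryTimeAverage` of the lead's skeleton
`Cruxes/CorrectorPressureDecay/Lines/FirstLemma.lean` (namespace
`Summit.AtomisticToContinuum.HydrodynamicLimit.Theorems.KiferCompactification`), proved verbatim.

ALMOST-STATIONARITY OF TIME AVERAGES (exact, finite `N`): for every hard-sphere flow `Φ` on `𝕋³`, every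
probability law `μ` on phase space, every bounded measurable `f` (`|f| ≤ C`), every window `T > 0` and shift
`s ≥ 0`,
`|T⁻¹∫₀ᵀ E_μ[f ∘ Φ_{t+s}] dt − T⁻¹∫₀ᵀ E_μ[f ∘ Φ_t] dt| ≤ 2 s C / T`:
the two time integrals differ by `T⁻¹(∫_T^{T+s} − ∫_0^s)` of a function bounded by `C`. Stated with the jointly
measurable piecewise flow `good.piecewise (Φ_t) id` (`= Φ_t` on the good set), so that `t ↦ E_μ[f ∘ Φ_t]` is a
bounded measurable function for every law `μ`. This is the finite-`N` seed of Kifer's compactness step: the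
time-averaged window tilt is `O(s/T)`-invariant, i.e. annihilated by the generator up to `2‖f‖/T`.
Proof adapted from the ideator's evidence file `IdeatorFourFirstLemma.lean` (planner-cruxidea-…-14135-4-0).
-/

noncomputable section

open MeasureTheory Set intervalIntegral

namespace Summit.AtomisticToContinuum.HydrodynamicLimit.Theorems.KiferCompactification

open Literature.MathematicalPhysics.KineticTheory (T3)
open Literature.Analysis.FluidPDE (HardSphereFlow Config)

open scoped Classical in
/-- **First lemma (almost-stationarity of time averages).** For every hard-sphere flow `Φ` on `𝕋³`, every
probability law `μ`, every bounded measurable `f` (`|f| ≤ C`), window `T > 0` and shift `s ≥ 0`: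
`|T⁻¹∫₀ᵀ E_μ[f ∘ Φ_{t+s}] dt − T⁻¹∫₀ᵀ E_μ[f ∘ Φ_t] dt| ≤ 2 s C / T` (piecewise-flow form). Registered stub
`stub_almostStationaryTimeAverage` of line `FirstLemma` (crux stmt-AtomisticToContinuum-14135). -/
theorem stub_almostStationaryTimeAverage (ε : ℝ) (N : ℕ)
    (Φ : HardSphereFlow (Literature.Analysis.FluidPDE.Torus.geometry (Fin 3)) ε (N + 1))
    (μ : Measure (Config (N + 1) (Fin 3) T3)) [IsProbabilityMeasure μ]
    (f : Config (N + 1) (Fin 3) T3 → ℝ) (C : ℝ) (hf : Measurable f) (hfC : ∀ z, |f z| ≤ C)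
    (T s : ℝ) (hT : 0 < T) (hs : 0 ≤ s) :
    |(T⁻¹ * ∫ t in (0 : ℝ)..T, ∫ z, f (Φ.good.piecewise (Φ.flow (t + s)) id z) ∂μ) -
        T⁻¹ * ∫ t in (0 : ℝ)..T, ∫ z, f (Φ.good.piecewise (Φ.flow t) id z) ∂μ| ≤ 2 * s * C / T := by
  -- the time-marginal `u t = E_μ[f ∘ Φ_t]`
  set u : ℝ → ℝ := fun t => ∫ z, f (Φ.good.piecewise (Φ.flow t) id z) ∂μ with hu
  -- joint measurability of `(t, z) ↦ f (Φ_t z)` and measurability of `u`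
  have hjoint : Measurable fun p : ℝ × Config (N + 1) (Fin 3) T3 =>
      f (Φ.good.piecewise (Φ.flow p.1) id p.2) :=
    hf.comp (Literature.MathematicalPhysics.KineticTheory.measurable_piecewise_flow_torus Φ)
  have hu_meas : Measurable u := by
    have : StronglyMeasurable (Function.uncurry fun (t : ℝ) (z : Config (N + 1) (Fin 3) T3) =>
        f (Φ.good.piecewise (Φ.flow t) id z)) := hjoint.stronglyMeasurable
    exact (this.integral_prod_right' (ν := μ)).measurable
  have hu_bound : ∀ t, ‖u t‖ ≤ C := by
    intro t
    have h1 : ‖∫ z, f (Φ.good.piecewise (Φ.flow t) id z) ∂μ‖ ≤ C * (μ Set.univ).toReal := by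
      refine norm_integral_le_of_norm_le_const ?_
      exact Filter.Eventually.of_forall fun z => by
        simpa [Real.norm_eq_abs] using hfC (Φ.good.piecewise (Φ.flow t) id z)
    simpa [measure_univ] using h1
  have hii : ∀ a b : ℝ, IntervalIntegrable u volume a b := by
    intro a b
    refine MeasureTheory.IntegrableOn.intervalIntegrable ?_
    refine Measure.integrableOn_of_bounded (μ := volume) (s := Set.uIcc a b) (M := C)
      isCompact_uIcc.measure_lt_top.ne hu_meas.aestronglyMeasurable ?_
    exact Filter.Eventually.of_forall fun t => hu_bound t
  -- shift: ∫₀ᵀ u(t+s) = ∫ₛ^{T+s} u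
  have hshift : (∫ t in (0 : ℝ)..T, u (t + s)) = ∫ t in s..(T + s), u t := by
    rw [intervalIntegral.integral_comp_add_right]
    simp
  -- split both integrals at the common piece `∫ₛᵀ u`
  have hsplit1 : (∫ t in s..(T + s), u t) = (∫ t in s..T, u t) + ∫ t in T..(T + s), u t :=
    (integral_add_adjacent_intervals (hii s T) (hii T (T + s))).symm
  have hsplit2 : (∫ t in (0 : ℝ)..T, u t) = (∫ t in (0 : ℝ)..s, u t) + ∫ t in s..T, u t :=
    (integral_add_adjacent_intervals (hii 0 s) (hii s T)).symm
  have hb1 : ‖∫ t in T..(T + s), u t‖ ≤ C * |T + s - T| :=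
    intervalIntegral.norm_integral_le_of_norm_le_const fun t _ => hu_bound t
  have hb2 : ‖∫ t in (0 : ℝ)..s, u t‖ ≤ C * |s - 0| :=
    intervalIntegral.norm_integral_le_of_norm_le_const fun t _ => hu_bound t
  have hdiff : |(∫ t in (0 : ℝ)..T, u (t + s)) - ∫ t in (0 : ℝ)..T, u t| ≤ 2 * s * C := by
    rw [hshift, hsplit1, hsplit2]
    have : (∫ t in s..T, u t) + (∫ t in T..(T + s), u t) - ((∫ t in (0:ℝ)..s, u t) + ∫ t in s..T, u t)
        = (∫ t in T..(T + s), u t) - ∫ t in (0:ℝ)..s, u t := by ring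
    rw [this]
    have hs1 : |T + s - T| = s := by rw [show T + s - T = s by ring, abs_of_nonneg hs]
    have hs2 : |s - 0| = s := by rw [sub_zero, abs_of_nonneg hs]
    rw [Real.norm_eq_abs, hs1] at hb1
    rw [Real.norm_eq_abs, hs2] at hb2
    calc |(∫ t in T..(T + s), u t) - ∫ t in (0:ℝ)..s, u t|
        ≤ |∫ t in T..(T + s), u t| + |∫ t in (0:ℝ)..s, u t| := abs_sub _ _
      _ ≤ C * s + C * s := add_le_add hb1 hb2
      _ = 2 * s * C := by ring
  -- divide by `T`
  have hTinv : 0 < T⁻¹ := inv_pos.2 hT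
  have key : |T⁻¹ * (∫ t in (0 : ℝ)..T, u (t + s)) - T⁻¹ * ∫ t in (0 : ℝ)..T, u t| ≤ 2 * s * C / T := by
    rw [← mul_sub, abs_mul, abs_of_pos hTinv, div_eq_inv_mul]
    exact mul_le_mul_of_nonneg_left hdiff hTinv.le
  exact key

end Summit.AtomisticToContinuum.HydrodynamicLimit.Theorems.KiferCompactification
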